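import Summits.Ventures.LatticeQCDFlow.Exactness.FlowSamplerSquareIntegrableDecay
import Summits.Ventures.LatticeQCDFlow.Exactness.Phi4FlowSquareIntegrable
import Summits.Ventures.LatticeQCDFlow.Exactness.Phi4AbelFloors
import Summits.Ventures.LatticeQCDFlow.Exactness.Phi4FlowSamplerGaussianMinorant
import HarnessLib

/-!
# Row 2's FLOW ARM: under a weight bound `e^{−S} ≤ C q̃` every polynomial observable of lattice φ⁴ — the magnetisation included — has `ρ(k) ≤ (1 − Z/C)ᵏ`, a SUMMABLE series and `τ_int ≤ C/Z − ½`

HONEST FRAMING: exact (Metropolis-corrected) sampling algorithms for lattice gauge theory;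
figures of merit are autocorrelation/cost numbers at stated couplings and volumes; no
continuum-physics claim.  (SCALAR calibration rung S0-A: not a gauge result.)

Venture `LatticeQCDFlow` (cell pub-lqcd), topic `Exactness`; FANOUT row 2 (`s0-phi4`, FLOW arm
`K = imhOpPhi4 J λ q̃`, every `λ > 0`, real `J`, positive measurable model density with `∫ q̃ = 1`).
NEW WORK of the cell: the lattice instances of `FlowSamplerSquareIntegrableCeiling`
(`imhOp_tauInt_le_weightBound_of_sq`) and `FlowSamplerSquareIntegrableDecay`
(`imhOp_autocov_le_pow_weightBound_of_sq`) on the class `PolyObs`.  Nothing is cited as a fact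
(Mengersen–Tweedie 1996 NAMED there).  The hypothesis `e^{−S(φ)} ≤ C q̃(φ)` for all `φ` is the
uniform-ergodicity condition of the tree's `Phi4FlowSamplerErgodic` / `…GaussianMinorant` (it holds
for every model density with a Gaussian MINORANT `q̃ ≥ c e^{−κΣφ²}` — affine-coupling flows with
bounded log-scales — since `e^{−S}` decays quartically: `gibbsWeight_le_of_gaussian_minorant`);
`C/Z = sup π/q̃` is the normalised weight bound `W`.

## What is proved (`Λ = Fin (n+1)`, `λ > 0`, `Z = ∫ e^{−S}`, `g = f − ⟨f⟩`)

* **`phi4Flow_tauInt_le_weightBound_poly`** — `f ∈ PolyObs` with `Var f > 0`, weight bound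
  `e^{−S} ≤ C q̃`: the normalised autocorrelation series of `f` under the flow arm IS SUMMABLE and
  `τ_int(f) ≤ C/Z − ½`;
* **`phi4Flow_tauInt_le_weightBound_magnetisation`** — the magnetisation (`Var M > 0` discharged by
  the tree's `Phi4AbelFloors`): `τ_int(M) ≤ C/Z − ½`, the series summable — with
  `Phi4FlowSquareIntegrable` the two-sided bracket
  `½ + r̄_M/(1 − r̄_M) ≤ τ_int(M) ≤ C/Z − ½` (the HMC arm has NO such ceiling: `Phi4HMCNoSpectralGap`);
* **`phi4Flow_tauInt_le_magnetisation_of_gaussian_minorant`** — the weight bound discharged from a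
  Gaussian minorant `q̃ ≥ c e^{−κΣφ²}` of the model density (`Phi4FlowSamplerGaussianMinorant`):
  `τ_int(M) ≤ e^{K}/(cZ) − ½`, `K = (n+1)(Σ|J| + κ)²/(4λ)`;
* **`phi4Flow_autocov_le_pow_weightBound_poly`** — termwise: `ρ_f(k) ≤ (1 − Z/C)ᵏ` for every
  `f ∈ PolyObs` and every lag (`FlowSamplerSquareIntegrableDecay`).

NOT CLAIMED: a weight bound or any value of `C/Z` for a trained network; sharpness.
-/

namespace Summit.Ventures.LatticeQCDFlow.Exactness

open Real MeasureTheory Filter Finset Set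
open Summit.Ventures.LatticeQCDFlow.Scoring

section Lattice

variable {n : ℕ}

/-- The centred observable `f − ⟨f⟩` of a `PolyObs f` has mean zero under `e^{−S} dφ` (`λ > 0`). -/
theorem integral_polyObs_sub_gibbsExpect {lam : ℝ} (hlam : 0 < lam)
    (J : Fin (n + 1) → Fin (n + 1) → ℝ) {f : (Fin (n + 1) → ℝ) → ℝ} (hf : PolyObs f) :
    ∫ φ, (f φ - gibbsExpect J lam f) * gibbsWeight J lam φ = 0 := by
  have hZ := gibbsZ_pos hlam J
  have hco := latticePhi4Action_coercive hlam J
  have ifw : Integrable (fun φ => f φ * gibbsWeight J lam φ) := by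
    have h := polyObs_integrable_mul_mul_gibbsWeight one_pos hco hf (polyObs_const 1)
    exact h.congr (Eventually.of_forall fun φ => by simp only [mul_one])
  have e : ∀ φ : Fin (n + 1) → ℝ, (f φ - gibbsExpect J lam f) * gibbsWeight J lam φ
      = f φ * gibbsWeight J lam φ - gibbsExpect J lam f * gibbsWeight J lam φ := fun φ => by ring
  simp_rw [e]
  rw [integral_sub ifw ((integrable_gibbsWeight hlam J).const_mul _), integral_const_mul]
  show (∫ φ, f φ * gibbsWeight J lam φ)
    - (∫ φ, f φ * gibbsWeight J lam φ) / gibbsZ J lam * gibbsZ J lam = 0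
  rw [div_mul_cancel₀ _ hZ.ne', sub_self]

/-- **THE FLOW ARM'S CEILING FOR EVERY POLYNOMIAL OBSERVABLE OF LATTICE φ⁴.**  `f ∈ PolyObs` with
`Var f > 0`; weight bound `e^{−S(φ)} ≤ C q̃(φ)` for all `φ`.  Then the normalised autocorrelation
series of `f` under `imhOpPhi4 J λ q̃` is summable and `τ_int(f) ≤ C/Z − ½`. -/
theorem phi4Flow_tauInt_le_weightBound_poly {lam : ℝ} (hlam : 0 < lam)
    (J : Fin (n + 1) → Fin (n + 1) → ℝ) {q : (Fin (n + 1) → ℝ) → ℝ} (hq0 : ∀ φ, 0 < q φ)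
    (hqm : Measurable q) (hqi : Integrable q) (hq1 : ∫ φ, q φ = 1) {C : ℝ}
    (hC : ∀ φ, gibbsWeight J lam φ ≤ C * q φ) {f : (Fin (n + 1) → ℝ) → ℝ} (hf : PolyObs f)
    (hP : 0 < ∫ φ, (f φ - gibbsExpect J lam f) ^ 2 * gibbsWeight J lam φ) :
    (Summable fun k => (∫ φ, (f φ - gibbsExpect J lam f)
        * ((imhOpPhi4 J lam q)^[k + 1] (fun ψ => f ψ - gibbsExpect J lam f)) φ * gibbsWeight J lam φ)
        / ∫ φ, (f φ - gibbsExpect J lam f) ^ 2 * gibbsWeight J lam φ) ∧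
    tauInt (fun k => (∫ φ, (f φ - gibbsExpect J lam f)
        * ((imhOpPhi4 J lam q)^[k] (fun ψ => f ψ - gibbsExpect J lam f)) φ * gibbsWeight J lam φ)
        / ∫ φ, (f φ - gibbsExpect J lam f) ^ 2 * gibbsWeight J lam φ)
      ≤ C / gibbsZ J lam - 1 / 2 := by
  have hZ := gibbsZ_pos hlam J
  obtain ⟨hgm, hg2⟩ := polyObs_sq_integrable hlam J (polyObs_sub_const hf (gibbsExpect J lam f))
  have hg0 := integral_polyObs_sub_gibbsExpect hlam J hf
  rw [imhOpPhi4_eq_imhOp]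
  have h := imhOp_tauInt_le_weightBound_of_sq (μ := volume) (fun φ => gibbsWeight_pos J lam φ)
    (continuous_gibbsWeight J lam).measurable (integrable_gibbsWeight hlam J) hq0 hqm hqi hq1 hC
    hgm hg2 hg0 hP
  have e : 1 / ((∫ φ, gibbsWeight J lam φ) / C) - 1 / 2 = C / gibbsZ J lam - 1 / 2 := by
    unfold gibbsZ
    rw [one_div_div]
  rw [e] at h
  exact h

/-- **THE MAGNETISATION'S CEILING UNDER THE FLOW ARM**: weight bound `e^{−S} ≤ C q̃` ⇒ the
autocorrelation series of `M` is summable and `τ_int(M) ≤ C/Z − ½` (`Var M > 0` is the tree's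
`integral_magnetisation_sub_sq_mul_gibbsWeight_pos`). -/
theorem phi4Flow_tauInt_le_weightBound_magnetisation {lam : ℝ} (hlam : 0 < lam)
    (J : Fin (n + 1) → Fin (n + 1) → ℝ) {q : (Fin (n + 1) → ℝ) → ℝ} (hq0 : ∀ φ, 0 < q φ)
    (hqm : Measurable q) (hqi : Integrable q) (hq1 : ∫ φ, q φ = 1) {C : ℝ}
    (hC : ∀ φ, gibbsWeight J lam φ ≤ C * q φ) :
    (Summable fun k => (∫ φ, ((∑ x, φ x) - gibbsExpect J lam (fun ψ => ∑ x, ψ x))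
        * ((imhOpPhi4 J lam q)^[k + 1]
            (fun ψ => (∑ x, ψ x) - gibbsExpect J lam (fun ψ => ∑ x, ψ x))) φ * gibbsWeight J lam φ)
        / ∫ φ, ((∑ x, φ x) - gibbsExpect J lam (fun ψ => ∑ x, ψ x)) ^ 2 * gibbsWeight J lam φ) ∧
    tauInt (fun k => (∫ φ, ((∑ x, φ x) - gibbsExpect J lam (fun ψ => ∑ x, ψ x))
        * ((imhOpPhi4 J lam q)^[k]
            (fun ψ => (∑ x, ψ x) - gibbsExpect J lam (fun ψ => ∑ x, ψ x))) φ * gibbsWeight J lam φ)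
        / ∫ φ, ((∑ x, φ x) - gibbsExpect J lam (fun ψ => ∑ x, ψ x)) ^ 2 * gibbsWeight J lam φ)
      ≤ C / gibbsZ J lam - 1 / 2 :=
  phi4Flow_tauInt_le_weightBound_poly hlam J hq0 hqm hqi hq1 hC polyObs_magnetisation
    (integral_magnetisation_sub_sq_mul_gibbsWeight_pos hlam J _)

/-- **A GAUSSIAN MINORANT OF THE FLOW'S DENSITY CAPS THE MAGNETISATION'S `τ_int`** (hypothesis read
off the network, as in `Phi4FlowSamplerGaussianMinorant`: affine-coupling flows with bounded
log-scales): `q̃ ≥ c e^{−κ Σ_w φ_w²}` with `c > 0` ⇒ the autocorrelation series of `M` under the flow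
arm is summable and `τ_int(M) ≤ e^{K}/(c Z) − ½`, `K = (n+1)(Σ|J| + κ)²/(4λ)`. -/
theorem phi4Flow_tauInt_le_magnetisation_of_gaussian_minorant {lam : ℝ} (hlam : 0 < lam)
    (J : Fin (n + 1) → Fin (n + 1) → ℝ) {q : (Fin (n + 1) → ℝ) → ℝ} (hq0 : ∀ φ, 0 < q φ)
    (hqm : Measurable q) (hqi : Integrable q) (hq1 : ∫ φ, q φ = 1) {c κ : ℝ} (hc : 0 < c)
    (hqc : ∀ φ, c * Real.exp (-(κ * ∑ w, φ w ^ 2)) ≤ q φ) :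
    (Summable fun k => (∫ φ, ((∑ x, φ x) - gibbsExpect J lam (fun ψ => ∑ x, ψ x))
        * ((imhOpPhi4 J lam q)^[k + 1]
            (fun ψ => (∑ x, ψ x) - gibbsExpect J lam (fun ψ => ∑ x, ψ x))) φ * gibbsWeight J lam φ)
        / ∫ φ, ((∑ x, φ x) - gibbsExpect J lam (fun ψ => ∑ x, ψ x)) ^ 2 * gibbsWeight J lam φ) ∧
    tauInt (fun k => (∫ φ, ((∑ x, φ x) - gibbsExpect J lam (fun ψ => ∑ x, ψ x))
        * ((imhOpPhi4 J lam q)^[k]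
            (fun ψ => (∑ x, ψ x) - gibbsExpect J lam (fun ψ => ∑ x, ψ x))) φ * gibbsWeight J lam φ)
        / ∫ φ, ((∑ x, φ x) - gibbsExpect J lam (fun ψ => ∑ x, ψ x)) ^ 2 * gibbsWeight J lam φ)
      ≤ Real.exp ((n + 1) * (((∑ y, ∑ z, |J y z|) + κ) ^ 2 / (4 * lam))) / c / gibbsZ J lam
        - 1 / 2 :=
  phi4Flow_tauInt_le_weightBound_magnetisation hlam J hq0 hqm hqi hq1
    (gibbsWeight_le_of_gaussian_minorant hlam J hc hqc)

/-- **GEOMETRIC DECORRELATION OF EVERY POLYNOMIAL OBSERVABLE UNDER A WEIGHT BOUND**: `e^{−S} ≤ C q̃`,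
`f ∈ PolyObs`, `g = f − ⟨f⟩`: `C_g(k) ≤ (1 − Z/C)ᵏ · ∫ g² e^{−S}` for every lag `k`, i.e.
`ρ_f(k) ≤ (1 − Z/C)ᵏ` — the magnetisation included (`FlowSamplerSquareIntegrableDecay`). -/
theorem phi4Flow_autocov_le_pow_weightBound_poly {lam : ℝ} (hlam : 0 < lam)
    (J : Fin (n + 1) → Fin (n + 1) → ℝ) {q : (Fin (n + 1) → ℝ) → ℝ} (hq0 : ∀ φ, 0 < q φ)
    (hqm : Measurable q) (hqi : Integrable q) (hq1 : ∫ φ, q φ = 1) {C : ℝ}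
    (hC : ∀ φ, gibbsWeight J lam φ ≤ C * q φ) {f : (Fin (n + 1) → ℝ) → ℝ} (hf : PolyObs f) (k : ℕ) :
    ∫ φ, (f φ - gibbsExpect J lam f)
        * ((imhOpPhi4 J lam q)^[k] (fun ψ => f ψ - gibbsExpect J lam f)) φ * gibbsWeight J lam φ
      ≤ (1 - gibbsZ J lam / C) ^ k * ∫ φ, (f φ - gibbsExpect J lam f) ^ 2 * gibbsWeight J lam φ := by
  obtain ⟨hgm, hg2⟩ := polyObs_sq_integrable hlam J (polyObs_sub_const hf (gibbsExpect J lam f))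
  have hg0 := integral_polyObs_sub_gibbsExpect hlam J hf
  rw [imhOpPhi4_eq_imhOp]
  exact imhOp_autocov_le_pow_weightBound_of_sq (μ := volume) (fun φ => gibbsWeight_pos J lam φ)
    (continuous_gibbsWeight J lam).measurable (integrable_gibbsWeight hlam J) hq0 hqm hqi hq1 hC
    hgm hg2 hg0 k

end Lattice

end Summit.Ventures.LatticeQCDFlow.Exactness
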